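import Literature.Geometry.Symplectic.SteinJCurveBoundary
import Literature.Analysis.Complex.SubharmonicLiouville
import HarnessLib

/-!
# Compact Stein domains contain no entire `J`-curves

Topic `Literature/Geometry/Symplectic`; proofs file of the fact seat of
`Literature.Geometry.Symplectic.Eliashberg1990_steinFilling_sphere_three` (`SteinFillingSphere.lean`,
Eliashberg (1990), Thm. 5.1).  For a Stein structure `S = (J, φ)` on a compact `4`-manifold with
boundary `W` (`SteinDomain.lean`) and a `C^∞` map `u : ℂ → W` with `du ∘ i = J ∘ du`
(`Literature.Geometry.Symplectic.IsJHolomorphic`), the function `φ ∘ u` is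

* subharmonic — `Δ(φ ∘ u) ≥ 0`, with `Δ(φ ∘ u)(z) > 0` wherever `du_z ≠ 0` (Eliashberg (1990),
  §1.1: a `J`-convex function is strictly subharmonic on `J`-holomorphic curves;
  `JConvexSubharmonic.lean`), hence with the sub-mean-value property (Hörmander Thm. 1.6.3,
  `SteinJCurveBoundary.lean`: `SteinStructure.φ_comp_le_circleAverage`);
* bounded above, by `max φ` (`W` is compact).

By **Liouville's theorem for subharmonic functions** (Ransford (1995), Cor. 2.3.4;
`Literature.Analysis.Complex.eq_apply_zero_of_subMeanValue_of_bddAbove`) `φ ∘ u` is constant, so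
`Δ(φ ∘ u) ≡ 0`, so `du ≡ 0`, so `u` is constant: **a compact Stein domain carries no
non-constant entire `J`-curve** (`SteinStructure.jCurve_const`, `SteinStructure.not_isEntireJCurve`).
This is the elementary shadow, for the tree's notions, of Sibony's theorem that a complex manifold
with a bounded plurisubharmonic function strictly plurisubharmonic near a point is Kobayashi
hyperbolic there (N. Sibony, *A class of hyperbolic manifolds*, in: Recent Developments in SCV,
Ann. of Math. Stud. 100 (1981), Thm. 3, held copy read), and it contains both the holomorphic
asphericity of Stein domains (`SteinFillingSphereProofs.lean`: no `J`-holomorphic spheres,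
Eliashberg (1990), §1.5) and the boundary statement of `SteinJCurveBoundary.lean`.  It also
settles, for compact Stein domains, the "entire `J`-curve" clauses of route
`SmoothPoincare4/SullivanDual` negatively.  Everything is proved; no definition, no named fact.

* `SteinStructure.φ_comp_const` — `φ ∘ u` is constant;
* `SteinStructure.jCurve_const` — **every smooth `J`-holomorphic `u : ℂ → W` is constant**;
* `SteinStructure.not_isEntireJCurve` — there is no entire `J`-curve in `W`.

## References

* Ya. Eliashberg, *Filling by holomorphic discs and its applications*, LMS Lecture Note Ser. 151
  (1990), 45–67, §1.1, §1.5. [Eliashberg1990]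
* T. Ransford, *Potential Theory in the Complex Plane*, LMS Student Texts 28 (1995), Cor. 2.3.4
  (Liouville theorem for subharmonic functions). [Ransford1995]
* N. Sibony, *A class of hyperbolic manifolds*, in: J. E. Fornaess (ed.), Recent Developments in
  Several Complex Variables, Ann. of Math. Stud. 100, Princeton (1981), 357–372, Thm. 3.
  [Fornaess1981]
-/

noncomputable section

open scoped Manifold ContDiff Topology
open Set Filter

namespace Literature.Geometry.Symplectic

open Literature.Geometry.Kaehler

namespace SteinStructure

variable {W : Type*} [TopologicalSpace W] [ChartedSpace (EuclideanHalfSpace 4) W]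
  [IsManifold (𝓡∂ 4) ∞ W] [T2Space W] [CompactSpace W]

/-- **`φ ∘ u` is constant along any smooth `J`-holomorphic `u : ℂ → W`** in a compact Stein
domain: it is continuous, has the sub-mean-value property (`φ_comp_le_circleAverage`) and is
bounded above by `max φ`, so Liouville's theorem for subharmonic functions applies
(`Literature.Analysis.Complex.eq_apply_zero_of_subMeanValue_of_bddAbove`, Ransford Cor. 2.3.4).
[cite: Ransford1995, Cor. 2.3.4] [cite: Eliashberg1990, §1.1] -/
theorem φ_comp_const (S : SteinStructure W) {u : ℂ → W}
    (hu : ContMDiff 𝓘(ℝ, ℂ) (𝓡∂ 4) ∞ u) (hJ : IsJHolomorphic (𝓡∂ 4) S.J u) (z : ℂ) :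
    S.φ (u z) = S.φ (u 0) :=
  Literature.Analysis.Complex.eq_apply_zero_of_subMeanValue_of_bddAbove (u := S.φ ∘ u)
    (S.φ_smooth.comp hu).continuous (fun w _ hr => S.φ_comp_le_circleAverage hu hJ w hr)
    (fun w => S.φ_le_sSup (u w)) z

/-- **A compact Stein domain contains no non-constant entire `J`-curve**: every `C^∞` map
`u : ℂ → W` with `du ∘ i = J ∘ du` for the complex structure `J` of a Stein structure on the
compact `W` is constant.  (`φ ∘ u` is constant by `φ_comp_const`, so its Laplacian vanishes;
but `Δ(φ ∘ u)(z) > 0` at every `z` with `du_z ≠ 0` (`IsJHolomorphic.laplacian_comp_pos`,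
Eliashberg (1990), §1.1), hence `du ≡ 0` and `u` is constant,
`apply_eq_apply_zero_of_mfderiv_eq_zero`.)  The elementary case, for the tree's notions, of
Sibony (1981), Thm. 3 (a bounded strictly plurisubharmonic function forces hyperbolicity).
[cite: Eliashberg1990, §1.1] [cite: Ransford1995, Cor. 2.3.4] [cite: Fornaess1981, pp. 357–372 (Sibony), Thm. 3] -/
theorem jCurve_const (S : SteinStructure W) {u : ℂ → W}
    (hu : ContMDiff 𝓘(ℝ, ℂ) (𝓡∂ 4) ∞ u) (hJ : IsJHolomorphic (𝓡∂ 4) S.J u) (z : ℂ) :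
    u z = u 0 := by
  have hconst : S.φ ∘ u = fun _ => S.φ (u 0) := funext fun w => S.φ_comp_const hu hJ w
  have hdu : ∀ w, mfderiv 𝓘(ℝ, ℂ) (𝓡∂ 4) u w = 0 := by
    intro w
    by_contra hne
    have hpos := hJ.laplacian_comp_pos S.preservesSmoothFields S.φ_smooth hu (S.convex (u w)) hne
    rw [hconst] at hpos
    simp at hpos
  exact apply_eq_apply_zero_of_mfderiv_eq_zero (hu.of_le (by exact_mod_cast le_top)) hdu z

/-- **There is no entire `J`-curve in a compact Stein domain** (an entire `J`-curve,
`Literature.Geometry.Symplectic.IsEntireJCurve`, is by definition non-constant).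
[cite: Eliashberg1990, §1.1] [cite: Ransford1995, Cor. 2.3.4] -/
theorem not_isEntireJCurve (S : SteinStructure W) (u : ℂ → W) : ¬ IsEntireJCurve (𝓡∂ 4) S.J u := by
  intro h
  obtain ⟨z, z', hne⟩ := h.exists_ne
  exact hne ((S.jCurve_const h.contMDiff h.isJHolomorphic z).trans
    (S.jCurve_const h.contMDiff h.isJHolomorphic z').symm)

end SteinStructure

end Literature.Geometry.Symplectic
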